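import Literature.MathematicalPhysics.QuantumFieldTheory.Balaban1983to89.B9Eq3132FacesAtLetters
import Literature.MathematicalPhysics.QuantumFieldTheory.Balaban1983to89.B9Eq3132NuReadingR
import Literature.MathematicalPhysics.QuantumFieldTheory.Balaban1983to89.B9Eq3132DecayFromMajorantR
import Literature.MathematicalPhysics.QuantumFieldTheory.Balaban1983to89.B9Eq3132CoerciveFromGAR
import Literature.MathematicalPhysics.QuantumFieldTheory.Balaban1983to89.B9Eq3132CoerciveFromEnergyR

/-!
# `Balaban1983to89.B9Eq3132FacesAtLettersR` — T. Bałaban, *Propagators for lattice gauge theories in a background field*, Commun. Math. Phys. **99** (1985)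
# 389–434 [Balaban1985BackgroundPropagators], (3.132) p. 422 under Theorem 3.12's prefix p. 423: ROW 26's KNIT FACE `s3132Nu_opsYSectE_of_step12` RE-PRESSED
# ONCE OVER THE CLASS-PARAMETRIC CARRIER `bg9YR 𝔸 G R₁ R₂` — the `s3132` binder of the R-GENERIC N06 certificate (`B9PinCarriersKLevelV1R.b9LeafX_carriersYR`)
# in ONE call (CASCADE-R STEP 2, n06-i share)

[4] = T. Bałaban, *Propagators and renormalization transformations for lattice gauge theories. II*, Commun. Math. Phys. **96** (1984) 223–250 [`Balaban1984PropagatorsII`].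

statement-level skeleton of published theorems with citation tags; proofs where landed; nothing here is a claim about the Yang–Mills mass gap

THE PRINT.  [B9] p. 422: *«The operators (QG̃Q*)⁻¹, or (QG₁Q*)⁻¹, can be analyzed in the same way as the operator (Q′G′²Q′*)⁻¹ in the proof of Theorem 3.2, and we get
|(QG̃Q*)⁻¹(U; y, y′)|, |(QG₁Q*)⁻¹(U; y, y′)| ≦ O(1)(Lʲη)⁻²(L^{j′}η)^{−d} exp(−δ d(y, y′)) (3.132)»*; p. 423 Theorem 3.12 (prefix *«If an external gauge field configuration U
satisfies both regularity conditions (3.35), (3.36) for α₀ sufficiently small»*); p. 396 (3.35)–(3.36) (the classes; *«U with values in G»*); Theorem 3.11 p. 416.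

WHY THIS FILE (dag-n06-i gen 21).  dag-n06-d g12's STEP-3 FACE CENSUS (2026-08-28) lists row 26's knit face `B9Eq3132FacesAtLetters.s3132Nu_opsYSectE_of_step12`
[n06-i] as «`bg9Y`-PINNED ✗ — R-twin = object re-typing + `MemOfFam`»; node00-def-Y g23 RULING-2 (α1): the R-generic certificate is pressed ONCE at
`carriersYR … R₁ R₂ ops`, whose row-26 binder reads `s3132 : B9.Stmt3132Printed (d + 1) c35Y geo9Y (bg9YR 𝔸 G R₁ R₂) (fun x => siteKernelR R₁ R₂ (ops x).QGQinv)
(fun x => siteKernelR R₁ R₂ (ops x).QG1Qinv)`, read at MODULE 3's families `(regY335, regY336)` by `rfl` today and at print's class later; owners append R-twins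
with `hU.1.1 ↦ mem_of_reg335R hG x hU` under a displayed `(hG : MemOfFam SU(N) R₁)`, class-CONTENT reads displayed as R-hypotheses.  This file assembles row 26's
R-face from the three re-pressed layers (`B9Eq3132DecayFromMajorantR`, `…CoerciveFromGAR`, `…CoerciveFromEnergyR`) and my g13 `B9Eq3132NuReadingR` exactly as
`B9Eq3132FacesAtLetters` assembles the Y-face: same section binders, now typed over `bg9YR 𝔸 G R₁ R₂ x` (walk model `𝔬 : Ops (geo9Y x) (bg9YR … x) …`, pins,
`hmodel`, ROW 17's `hΔA`), plus the displayed class hypotheses — `hG : MemOfFam SU(N) R₁` always, and for the tent energy EITHER `hP1` itself (carrier-typed) OR the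
refinement `hY` of MODULE 3's class at some constant `c′` (`B9Eq3132CoerciveFromEnergyR` §3).

WHAT IS PROVED (sorry-free, 0 def; `𝔸 = M_N(ℂ)`, `G = SU(N)`).
* §1 ★★ `s3132Nu_opsYSectE_of_ringInverse_R (R₁ R₂) (𝔏 𝔈 𝔢 𝔴) b (S S₁) (hS hS₁) hco hdec hco₁ hdec₁` — `B9.Stmt3132Printed (d+1) c35 geo9Y (bg9YR … R₁ R₂)` for
  the two row-26 kernels of the `ν`-instance `opsYSectE … (opsYS349NuOfLetters … 𝔏 𝔈) 𝔏 𝔢 𝔴` READ THROUGH `siteKernelR R₁ R₂` (the `carriersYR` slot shape), over ANY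
  letters family whose `(QGQ*)⁻¹ ∕ (QG₁Q*)⁻¹` fields are ring inverses of `S`, `S₁`, from the four carrier-typed Λ-normalised binders (`stmt3132Printed_nu_of_coercive_decay_R`).
* §2 the shared carrier-typed binders (section variables).
* §3 `hdec26_of_majorants_of_R` (hG), ★ `hdec26_of_step12_of_R` (hG) — the two `DecayUnder` binders at the carrier from ROW 20's displayed inputs.
* §4 ★ `hco26_of_hcoA_step12_of_R` (hG), ★★ `hco26_of_energy_step12_of_R` (hG; `hP1` displayed), ★★ `hco26_of_refinesY_step12_of_R` (hG, hY) — the two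
  `CoerciveUnder` binders at the carrier from ROW 17's `hΔA` and ROW 20's inputs.
* §5 ★★★ `s3132Nu_opsYSectE_of_step12_R` (displays `hG`, `hP1`) and ★★★ `s3132Nu_opsYSectE_of_step12_R_of_refinesY` (displays `hG`, `hY`) — ROW 26 OF THE
  R-GENERIC CERTIFICATE IN ONE CALL from ROW 20's inputs and ROW 17's `hΔA`; at `(regY335, regY336)` with `hG := memOfFam_regY335`, `hY := fun _ _ _ h h' => ⟨h, h'⟩`
  (`c′ = c35`) it is `s3132Nu_opsYSectE_of_step12` read at the carrier (`bg9Y = bg9YR regY335 regY336`, `rfl`).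
* §6 (v1.1) `hco26_of_refinesYPos_step12_of_R`, ★★★ `s3132Nu_opsYSectE_of_step12_R_of_refinesYPos` — the same with `hY` asked only for `0 < α₀` (the
  shape dag-n06-j's P-bridge inhabits, `c′ = 10·L⁴`); the RECOMMENDED knit form.

CONSUMER NOTE (dag-n06-d, the R-edition).  With `𝔬12R : ∀ x, Ops (geo9Y x) (bg9YR … R₁ R₂ x) …` (the same record literal as `𝔬12`), the pins phrased at the
carrier and `hmodel12 ∕ hΔA` premised on `(bg9YR … x).Reg335∕336`: `s3132 := s3132Nu_opsYSectE_of_step12_R_of_refinesY θ' M⋆ R₁ R₂ hG hY (trBasis N) 𝔬12R H T T₁ T₀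
(fun _ _ => rfl) hblk12 hGco12 hG1co12 hG0co12 hlev hβ1 hnbr θ12 … hmodel12 a311 M311 ha311 hM311 hΔA 𝔏⁺ 𝔈 𝔢 𝔴 (fun _ => rfl) (fun _ => rfl)` with
`T := fun x => (𝔏⁺ x).GD`, `T₁ := (…).G₁`, `T₀ := (…).GA` — the Y-closer supplies `hG := memOfFam_regY335`, `hY := fun _ _ _ h h' => ⟨h, h'⟩`.

HONEST SCOPE.  Re-typing bookkeeping (CASCADE-R STEP 2) of a LANDED derivation; the (3.35)∕(3.36) classes are PARAMETERS and every class use is a named binder;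
Theorem 3.3 for `G₀`, the steps, the identities (ROW 20) and Theorem 3.11's `hΔA` (ROW 17) remain those rows' displayed hypotheses; nothing of [B9] or [4] is
asserted; count-neutral; N06 NOT discharged; one finite 𝕋^{d+1} programme at fixed ε — nothing continuum, nothing OS, nothing about the mass gap.  Cell `pub-ymgap`
(HUMAN RULING D-0062), Track A node N06 [B9], seat `pub-ymgap-dag-n06-i` (gen 21), 2026-08-28; a NEW file (APPEND-ONLY companion of `B9Eq3132FacesAtLetters`, untouched).
-/

noncomputable section

namespace Literature.MathematicalPhysics.QuantumFieldTheory.Balaban1983to89.B9Eq3132FacesAtLettersR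

open Node00
open B6RandomWalk (HasMajorant)
open B6GlobalChartV1 (blkV1)
open B6Ineq2142KLevelV1 (lvl β)
open B9Thm34Ext (toB6)
open B9Thm312Whole (Ops Thm33G0 Step FormSmall Identities GeoOK)
open B9PinMembersKLevelV1 (MemberY geo9Y bg9Y)
open B9BackgroundsKLevelV1R (RegFamY bg9YR regY335 regY336 siteKernelR MemOfFam mem_of_reg335R)
open B7Prop2SpecialUnitary (specialUnitaryUnits specialUnitaryUnits_le_unitaryUnits)
open B9Ineq349SiteFromConv342 (contractive_of_mem)
open B9CoReadingCoords (XBK blkBK GcoK)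
open B9CoReadingCoordsTranspose (TrIdx trBasis)
open B9Thm311ReadingCoords (trIP PosDefTr)
open B9RWSumsReadsNbr (nbr)
open B9Eq3132RingInverseReading (normMatY)
open B9Eq3132NuReading (lamInvY nuY siteKernelOfOpNu opsYS349NuOfLetters)
open B9Eq3132NuReadingR (stmt3132Printed_nu_of_coercive_decay_R)
open B9Eq3132CTInputs (CoerciveUnder DecayUnder)
open B9Eq3132ScalarIndex (geoComap)
open B9Eq3132TentOperator (tentOp)
open B9Eq3132ApproxRightInverse (bumpProfile)
open B9Eq3132DecayFromMajorantR (decayUnder_QGQOfY_of_majorants_R majorants_of_step12_R)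
open B9Eq3132CoerciveFromGAR (subMajorants_of_step12_R coerciveUnder_of_subMajorants_R)
open B9Eq3132CoerciveFromEnergyR (hcoA_of_energy_R hcoA_of_refinesY_R hcoA_of_refinesYPos_R)
open scoped Matrix.Norms.L2Operator

variable {κ : Type} [Fintype κ] [DecidableEq κ] {Ff : Type} [Fintype Ff] [DecidableEq Ff] {N : ℕ}

/-! ## §1 ★★ ROW 26's DISPLAY FACE AT THE `ν`-INSTANCE OVER A LETTERS FAMILY, KERNELS READ THROUGH `siteKernelR R₁ R₂` -/

section NuFace

/-- ★★ **ROW 26 (`B9.Stmt3132Printed`) AT THE CLASS-PARAMETRIC CARRIER FOR THE `ν`-INSTANCE `opsYSectE … (opsYS349NuOfLetters … 𝔏 𝔈) 𝔏 𝔢 𝔴` OVER ANY LETTERS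
FAMILY `𝔏`, KERNELS READ THROUGH `siteKernelR R₁ R₂`** (the `carriersYR` slot shape), whose `(QGQ*)⁻¹ ∕ (QG₁Q*)⁻¹` fields are the ring inverses of two coarse-bond
letters `S`, `S₁` (`hS ∕ hS₁`, `rfl` at every `withSectD ∕ withDE`-built record), from the four carrier-typed Λ-normalised Combes–Thomas binders — the R-twin of
`B9Eq3132FacesAtLetters.s3132Nu_opsYSectE_of_ringInverse` via my g13 `B9Eq3132NuReadingR.stmt3132Printed_nu_of_coercive_decay_R` (the re-typed kernels ARE the
`ν`-readings at `bg9YR`, `rfl`); no class hypothesis. [cite: Balaban1985BackgroundPropagators, (3.132) p.422, Thm 3.12 p.423 (prefix), (3.35)–(3.36) p.396; Balaban1984PropagatorsII, (2.142) (2.147) p.248, Prop. 2.7 (2.149) p.249] -/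
theorem s3132Nu_opsYSectE_of_ringInverse_R (θ : Stage3Params) (Mstar : ℕ)
    (R₁ R₂ : RegFamY θ.d₆ θ.ℓ₆ θ.hd' θ.hL' θ.b₀ θ.b₁ Mstar (Matrix (Fin N) (Fin N) ℂ)) {c35 : ℝ}
    [∀ x : MemberY θ.d₆ θ.ℓ₆ θ.hd' θ.hL' θ.b₀ θ.b₁ Mstar, Fintype (geo9Y x).Site] [∀ x : MemberY θ.d₆ θ.ℓ₆ θ.hd' θ.hL' θ.b₀ θ.b₁ Mstar, DecidableEq (geo9Y x).Site]
    (𝔏 : LettersY N θ Mstar) (𝔈 : ExpsY N θ Mstar) (𝔢 : SectEY N θ Mstar) (𝔴 : RWEY N θ Mstar) (b : Module.Basis Ff ℝ (Matrix (Fin N) (Fin N) ℂ))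
    (S S₁ : ∀ x : MemberY θ.d₆ θ.ℓ₆ θ.hd' θ.hL' θ.b₀ θ.b₁ Mstar, CfgY (Matrix (Fin N) (Fin N) ℂ) x.toKIdx → Module.End ℂ ((geo9Y x).Site → Matrix (Fin N) (Fin N) ℂ))
    (hS : ∀ x : MemberY θ.d₆ θ.ℓ₆ θ.hd' θ.hL' θ.b₀ θ.b₁ Mstar, (𝔏 x).QGQinv = fun U => Ring.inverse (S x U))
    (hS₁ : ∀ x : MemberY θ.d₆ θ.ℓ₆ θ.hd' θ.hL' θ.b₀ θ.b₁ Mstar, (𝔏 x).QG1Qinv = fun U => Ring.inverse (S₁ x U))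
    (hco : CoerciveUnder c35 (fun x : MemberY θ.d₆ θ.ℓ₆ θ.hd' θ.hL' θ.b₀ θ.b₁ Mstar => geoComap (geo9Y x) (Prod.fst : (geo9Y x).Site × Ff → (geo9Y x).Site))
      (bg9YR (Matrix (Fin N) (Fin N) ℂ) (specialUnitaryUnits (Fin N)) R₁ R₂) (fun x U => normMatY b (lamInvY x.toKIdx) (S x U)))
    (hdec : DecayUnder c35 (fun x : MemberY θ.d₆ θ.ℓ₆ θ.hd' θ.hL' θ.b₀ θ.b₁ Mstar => geoComap (geo9Y x) (Prod.fst : (geo9Y x).Site × Ff → (geo9Y x).Site))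
      (bg9YR (Matrix (Fin N) (Fin N) ℂ) (specialUnitaryUnits (Fin N)) R₁ R₂) (fun x U => normMatY b (lamInvY x.toKIdx) (S x U)))
    (hco₁ : CoerciveUnder c35 (fun x : MemberY θ.d₆ θ.ℓ₆ θ.hd' θ.hL' θ.b₀ θ.b₁ Mstar => geoComap (geo9Y x) (Prod.fst : (geo9Y x).Site × Ff → (geo9Y x).Site))
      (bg9YR (Matrix (Fin N) (Fin N) ℂ) (specialUnitaryUnits (Fin N)) R₁ R₂) (fun x U => normMatY b (lamInvY x.toKIdx) (S₁ x U)))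
    (hdec₁ : DecayUnder c35 (fun x : MemberY θ.d₆ θ.ℓ₆ θ.hd' θ.hL' θ.b₀ θ.b₁ Mstar => geoComap (geo9Y x) (Prod.fst : (geo9Y x).Site × Ff → (geo9Y x).Site))
      (bg9YR (Matrix (Fin N) (Fin N) ℂ) (specialUnitaryUnits (Fin N)) R₁ R₂) (fun x U => normMatY b (lamInvY x.toKIdx) (S₁ x U))) :
    B9.Stmt3132Printed (θ.d₆ + 1) c35 (geo9Y (d := θ.d₆) (ℓ := θ.ℓ₆) (hd := θ.hd') (hL := θ.hL') (b₀ := θ.b₀) (b₁ := θ.b₁) (Mstar := Mstar))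
      (bg9YR (Matrix (Fin N) (Fin N) ℂ) (specialUnitaryUnits (Fin N)) R₁ R₂)
      (fun x => siteKernelR R₁ R₂ (opsYSectE N θ Mstar (opsYS349NuOfLetters N θ Mstar 𝔏 𝔈) 𝔏 𝔢 𝔴 x).QGQinv)
      (fun x => siteKernelR R₁ R₂ (opsYSectE N θ Mstar (opsYS349NuOfLetters N θ Mstar 𝔏 𝔈) 𝔏 𝔢 𝔴 x).QG1Qinv) := by
  have h0 : (fun x => siteKernelR R₁ R₂ (opsYSectE N θ Mstar (opsYS349NuOfLetters N θ Mstar 𝔏 𝔈) 𝔏 𝔢 𝔴 x).QGQinv) =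
      fun x => siteKernelOfOpNu x.toKIdx (bg9YR (Matrix (Fin N) (Fin N) ℂ) (specialUnitaryUnits (Fin N)) R₁ R₂ x) (fun U => U) (nuY (θ.d₆ + 1) x.toKIdx)
        (fun U => Ring.inverse (S x U)) :=
    funext fun x => congrArg (siteKernelOfOpNu x.toKIdx (bg9YR (Matrix (Fin N) (Fin N) ℂ) (specialUnitaryUnits (Fin N)) R₁ R₂ x) (fun U => U)
      (nuY (θ.d₆ + 1) x.toKIdx)) (hS x)
  have h1 : (fun x => siteKernelR R₁ R₂ (opsYSectE N θ Mstar (opsYS349NuOfLetters N θ Mstar 𝔏 𝔈) 𝔏 𝔢 𝔴 x).QG1Qinv) =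
      fun x => siteKernelOfOpNu x.toKIdx (bg9YR (Matrix (Fin N) (Fin N) ℂ) (specialUnitaryUnits (Fin N)) R₁ R₂ x) (fun U => U) (nuY (θ.d₆ + 1) x.toKIdx)
        (fun U => Ring.inverse (S₁ x U)) :=
    funext fun x => congrArg (siteKernelOfOpNu x.toKIdx (bg9YR (Matrix (Fin N) (Fin N) ℂ) (specialUnitaryUnits (Fin N)) R₁ R₂ x) (fun U => U)
      (nuY (θ.d₆ + 1) x.toKIdx)) (hS₁ x)
  rw [h0, h1]
  exact stmt3132Printed_nu_of_coercive_decay_R (specialUnitaryUnits (Fin N)) R₁ R₂ b (θ.d₆ + 1) S S₁ hco hdec hco₁ hdec₁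

end NuFace

/-! ## §2 The shared carrier-typed binders: letters `T ∕ T₁ ∕ T₀`, ROW 20's walk model over `bg9YR … R₁ R₂ x` at pins naming them, its inputs, ROW 17's `hΔA` -/

section Faces

variable (θ : Stage3Params) (Mstar : ℕ) (R₁ R₂ : RegFamY θ.d₆ θ.ℓ₆ θ.hd' θ.hL' θ.b₀ θ.b₁ Mstar (Matrix (Fin N) (Fin N) ℂ))
  (hG : MemOfFam (specialUnitaryUnits (Fin N)) R₁)
  [∀ x : MemberY θ.d₆ θ.ℓ₆ θ.hd' θ.hL' θ.b₀ θ.b₁ Mstar, Fintype (geo9Y x).Site] [∀ x : MemberY θ.d₆ θ.ℓ₆ θ.hd' θ.hL' θ.b₀ θ.b₁ Mstar, DecidableEq (geo9Y x).Site]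
  {Y Z W : MemberY θ.d₆ θ.ℓ₆ θ.hd' θ.hL' θ.b₀ θ.b₁ Mstar → Type} [∀ x, Fintype (Z x)] [∀ x, Fintype (W x)]
  (bK : Module.Basis κ ℝ (Matrix (Fin N) (Fin N) ℂ)) (b : Module.Basis Ff ℝ (Matrix (Fin N) (Fin N) ℂ)) {c35 : ℝ}
  (𝔬 : ∀ x : MemberY θ.d₆ θ.ℓ₆ θ.hd' θ.hL' θ.b₀ θ.b₁ Mstar, Ops (geo9Y x) (bg9YR (Matrix (Fin N) (Fin N) ℂ) (specialUnitaryUnits (Fin N)) R₁ R₂ x) (XBK κ x.toKIdx) (Y x) (Z x) (W x))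
  (H₀ : MemberY θ.d₆ θ.ℓ₆ θ.hd' θ.hL' θ.b₀ θ.b₁ Mstar → Prop)
  -- the Sect.-D propagator letters `T = G_D(U)`, `T₁ = G₁(U)` (ANY) and `T₀ = G_A(U) = Δ_a(U)⁻¹`
  (T T₁ T₀ : ∀ x : MemberY θ.d₆ θ.ℓ₆ θ.hd' θ.hL' θ.b₀ θ.b₁ Mstar, BondOpY (Matrix (Fin N) (Fin N) ℂ) x.toKIdx)
  (hT₀ : ∀ (x : MemberY θ.d₆ θ.ℓ₆ θ.hd' θ.hL' θ.b₀ θ.b₁ Mstar) (U : CfgY (Matrix (Fin N) (Fin N) ℂ) x.toKIdx), T₀ x U = Ring.inverse (deltaAY x.toKIdx (parSymY x.toKIdx) (parBY x.toKIdx) (GpY x.toKIdx (parSymY x.toKIdx)) U))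
  {bI : ∀ x : MemberY θ.d₆ θ.ℓ₆ θ.hd' θ.hL' θ.b₀ θ.b₁ Mstar, FBondY x.toKIdx → IBondY x.toKIdx} (hblk : ∀ x, (𝔬 x).blk = blkBK x.toKIdx (bI x))
  (hGco : ∀ (x : MemberY θ.d₆ θ.ℓ₆ θ.hd' θ.hL' θ.b₀ θ.b₁ Mstar) (U : (bg9YR (Matrix (Fin N) (Fin N) ℂ) (specialUnitaryUnits (Fin N)) R₁ R₂ x).Cfg), (𝔬 x).G U = GcoK x.toKIdx bK (bg9YR (Matrix (Fin N) (Fin N) ℂ) (specialUnitaryUnits (Fin N)) R₁ R₂ x) (fun U => U) (T x) U)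
  (hG1co : ∀ (x : MemberY θ.d₆ θ.ℓ₆ θ.hd' θ.hL' θ.b₀ θ.b₁ Mstar) (U : (bg9YR (Matrix (Fin N) (Fin N) ℂ) (specialUnitaryUnits (Fin N)) R₁ R₂ x).Cfg), (𝔬 x).G1 U = GcoK x.toKIdx bK (bg9YR (Matrix (Fin N) (Fin N) ℂ) (specialUnitaryUnits (Fin N)) R₁ R₂ x) (fun U => U) (T₁ x) U)
  (hG0co : ∀ (x : MemberY θ.d₆ θ.ℓ₆ θ.hd' θ.hL' θ.b₀ θ.b₁ Mstar) (U : (bg9YR (Matrix (Fin N) (Fin N) ℂ) (specialUnitaryUnits (Fin N)) R₁ R₂ x).Cfg), (𝔬 x).G0 U = GcoK x.toKIdx bK (bg9YR (Matrix (Fin N) (Fin N) ℂ) (specialUnitaryUnits (Fin N)) R₁ R₂ x) (fun U => U) (T₀ x) U)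
  (hlev : ∀ (x : MemberY θ.d₆ θ.ℓ₆ θ.hd' θ.hL' θ.b₀ θ.b₁ Mstar) (f : FBondY x.toKIdx), lvl x.hN x.D x.hk (bI x f) = (blkV1 x.hN x.D f).1.1)
  (hβ1 : ∀ (x : MemberY θ.d₆ θ.ℓ₆ θ.hd' θ.hL' θ.b₀ θ.b₁ Mstar) (f : FBondY x.toKIdx), (B6Geom246MultiLevelTorus.geomT x.D).dist (β x.hN x.D x.hk (bI x f)) (blkV1 x.hN x.D f) ≤ 1)
  {mN : ℕ} (hnbr : ∀ (x : MemberY θ.d₆ θ.ℓ₆ θ.hd' θ.hL' θ.b₀ θ.b₁ Mstar) (y : (geo9Y x).Site), (nbr (geo9Y x) ((θ.ℓ₆ : ℝ) + 4) y).card ≤ mN)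
  {R : MemberY θ.d₆ θ.ℓ₆ θ.hd' θ.hL' θ.b₀ θ.b₁ Mstar → ℝ} {H : MemberY θ.d₆ θ.ℓ₆ θ.hd' θ.hL' θ.b₀ θ.b₁ Mstar → Prop}
  (θ₁ r₁ B₀ δ₀ δK σ ρ a₁ M₁ : ℝ) (hθ₁ : 0 ≤ θ₁) (hB₀ : 0 ≤ B₀) (hσ : 0 < σ) (hρ : 0 < ρ) (hρS : ρ ≤ δ₀) (hρδ : ρ + σ ≤ δK)
  (ha₁ : 0 < a₁) (hM₁ : 0 < M₁) (hgeo : ∀ x : MemberY θ.d₆ θ.ℓ₆ θ.hd' θ.hL' θ.b₀ θ.b₁ Mstar, GeoOK (geo9Y x))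
  (hmodel : ∀ x : MemberY θ.d₆ θ.ℓ₆ θ.hd' θ.hL' θ.b₀ θ.b₁ Mstar, M₁ ≤ (geo9Y x).M → ∀ α₀ : ℝ, 0 < α₀ → (geo9Y x).M * α₀ ≤ a₁ → ∀ U : (bg9YR (Matrix (Fin N) (Fin N) ℂ) (specialUnitaryUnits (Fin N)) R₁ R₂ x).Cfg,
    (bg9YR (Matrix (Fin N) (Fin N) ℂ) (specialUnitaryUnits (Fin N)) R₁ R₂ x).Reg335 c35 α₀ U → (bg9YR (Matrix (Fin N) (Fin N) ℂ) (specialUnitaryUnits (Fin N)) R₁ R₂ x).Reg336 c35 α₀ U →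
      Thm33G0 (𝔬 x) 1 (H₀ x) B₀ δ₀ U ∧ Step (𝔬 x) 1 (H₀ x) (hgeo x).lenle 1 (θ₁ * ((geo9Y x).M * α₀)) δK U ∧
        Step (𝔬 x) 1 (H₀ x) (hgeo x).lenle 2 (θ₁ * ((geo9Y x).M * α₀)) δK U ∧ FormSmall (𝔬 x) (r₁ * ((geo9Y x).M * α₀)) U ∧ Identities (𝔬 x) U)
  (a311 M311 : ℝ) (ha311 : 0 < a311) (hM311 : 0 < M311)
  (hΔA : ∀ x : MemberY θ.d₆ θ.ℓ₆ θ.hd' θ.hL' θ.b₀ θ.b₁ Mstar, M311 ≤ (geo9Y x).M → ∀ α₀ : ℝ, 0 < α₀ → (geo9Y x).M * α₀ ≤ a311 → ∀ U : (bg9YR (Matrix (Fin N) (Fin N) ℂ) (specialUnitaryUnits (Fin N)) R₁ R₂ x).Cfg, (bg9YR (Matrix (Fin N) (Fin N) ℂ) (specialUnitaryUnits (Fin N)) R₁ R₂ x).Reg335 c35 α₀ U →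
    PosDefTr (fun _ => (1 : ℝ)) (deltaAY x.toKIdx (parSymY x.toKIdx) (parBY x.toKIdx) (GpY x.toKIdx (parSymY x.toKIdx)) U))
  -- the tent energy bound (P′1), carrier-typed (the one class-CONTENT read; §4∕§5 `_of_refinesY` discharge it from a refinement of MODULE 3's class)
  (hP1 : ∃ Mt aT C : ℝ, 0 < Mt ∧ 0 < aT ∧ 0 < C ∧ ∀ x : MemberY θ.d₆ θ.ℓ₆ θ.hd' θ.hL' θ.b₀ θ.b₁ Mstar, Mt ≤ (geo9Y x).M → ∀ α₀ : ℝ, 0 < α₀ → (geo9Y x).M * α₀ ≤ aT →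
    ∀ U : (bg9YR (Matrix (Fin N) (Fin N) ℂ) (specialUnitaryUnits (Fin N)) R₁ R₂ x).Cfg, (bg9YR (Matrix (Fin N) (Fin N) ℂ) (specialUnitaryUnits (Fin N)) R₁ R₂ x).Reg335 c35 α₀ U → (bg9YR (Matrix (Fin N) (Fin N) ℂ) (specialUnitaryUnits (Fin N)) R₁ R₂ x).Reg336 c35 α₀ U → ∀ Ψ : IBondY x.toKIdx → Matrix (Fin N) (Fin N) ℂ,
      trIP (fun _ => (1 : ℝ)) (tentOp x.toKIdx (bumpProfile x.toKIdx) U Ψ)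
          (deltaAY x.toKIdx (parSymY x.toKIdx) (parBY x.toKIdx) (GpY x.toKIdx (parSymY x.toKIdx)) U (tentOp x.toKIdx (bumpProfile x.toKIdx) U Ψ)) ≤
        C * trIP (fun _ => (1 : ℝ)) Ψ Ψ)
  -- the refinement of MODULE 3's class at some constant `c′` (`⟨h, h'⟩` at `(regY335, regY336)` with `c′ = c35`; dag-n06-j's bridge at print's class)
  {c' : ℝ}
  (hY : ∀ (x : MemberY θ.d₆ θ.ℓ₆ θ.hd' θ.hL' θ.b₀ θ.b₁ Mstar) (α₀ : ℝ) (U : CfgY (Matrix (Fin N) (Fin N) ℂ) x.toKIdx), R₁ x c35 α₀ U → R₂ x c35 α₀ U →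
    regY335 (Matrix (Fin N) (Fin N) ℂ) (specialUnitaryUnits (Fin N)) x c' α₀ U ∧ regY336 (Matrix (Fin N) (Fin N) ℂ) (specialUnitaryUnits (Fin N)) x c' α₀ U)

/-! ## §3 ★ ROW 26's TWO DECAY BINDERS AT THE CARRIER -/

include hG hlev hβ1 hnbr in
/-- ★ **THE DECAY BINDERS FOR `(Q T(U) Q*)` AND `(Q T₁(U) Q*)` AT THE CARRIER FROM THE [4]-(2.51) MAJORANTS OF THEIR COORDINATE MODELS** (faithful `bI`, radius-`(ℓ+4)`
count; the bond transporters `parBY` are `SU(N)`-valued on the carrier's (3.35) by `hG`, hence contractive) — the R-twin of `B9Eq3132FacesAtLetters.hdec26_of_majorants_of`.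
[cite: Balaban1985BackgroundPropagators, (3.132) p.422, Thm 3.12 p.423 (prefix), (3.35) p.396; Balaban1984PropagatorsII, (2.142) p.248, (2.149) p.249, Lemma 2.1 (2.60) p.234] -/
theorem hdec26_of_majorants_of_R
    (h : ∃ M₂ a₂ C δ : ℝ, 0 < M₂ ∧ 0 < a₂ ∧ 0 ≤ C ∧ 0 < δ ∧ ∀ x : MemberY θ.d₆ θ.ℓ₆ θ.hd' θ.hL' θ.b₀ θ.b₁ Mstar, M₂ ≤ (geo9Y x).M → ∀ α₀ : ℝ, 0 < α₀ → (geo9Y x).M * α₀ ≤ a₂ →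
      ∀ U : (bg9YR (Matrix (Fin N) (Fin N) ℂ) (specialUnitaryUnits (Fin N)) R₁ R₂ x).Cfg, (bg9YR (Matrix (Fin N) (Fin N) ℂ) (specialUnitaryUnits (Fin N)) R₁ R₂ x).Reg335 c35 α₀ U → (bg9YR (Matrix (Fin N) (Fin N) ℂ) (specialUnitaryUnits (Fin N)) R₁ R₂ x).Reg336 c35 α₀ U →
        HasMajorant (g := toB6 (geo9Y x) (R x) (H x)) (blkBK x.toKIdx (bI x)) (GcoK x.toKIdx bK (bg9YR (Matrix (Fin N) (Fin N) ℂ) (specialUnitaryUnits (Fin N)) R₁ R₂ x) (fun U => U) (T x) U)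
            (fun a a' => C * (geo9Y x).len a ^ 2 * Real.exp (-(δ * (geo9Y x).dist a a'))) ∧
          HasMajorant (g := toB6 (geo9Y x) (R x) (H x)) (blkBK x.toKIdx (bI x)) (GcoK x.toKIdx bK (bg9YR (Matrix (Fin N) (Fin N) ℂ) (specialUnitaryUnits (Fin N)) R₁ R₂ x) (fun U => U) (T₁ x) U)
            (fun a a' => C * (geo9Y x).len a ^ 2 * Real.exp (-(δ * (geo9Y x).dist a a')))) :
    DecayUnder c35 (fun x : MemberY θ.d₆ θ.ℓ₆ θ.hd' θ.hL' θ.b₀ θ.b₁ Mstar => geoComap (geo9Y x) (Prod.fst : (geo9Y x).Site × Ff → (geo9Y x).Site))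
        (bg9YR (Matrix (Fin N) (Fin N) ℂ) (specialUnitaryUnits (Fin N)) R₁ R₂) (fun x U => normMatY b (lamInvY x.toKIdx) (QGQOfY x.toKIdx (parBY x.toKIdx) (T x) U)) ∧
      DecayUnder c35 (fun x : MemberY θ.d₆ θ.ℓ₆ θ.hd' θ.hL' θ.b₀ θ.b₁ Mstar => geoComap (geo9Y x) (Prod.fst : (geo9Y x).Site × Ff → (geo9Y x).Site))
        (bg9YR (Matrix (Fin N) (Fin N) ℂ) (specialUnitaryUnits (Fin N)) R₁ R₂) (fun x U => normMatY b (lamInvY x.toKIdx) (QGQOfY x.toKIdx (parBY x.toKIdx) (T₁ x) U)) := by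
  obtain ⟨M₂, a₂, C, δ, hM₂, ha₂, hC, hδ, hmaj⟩ := h
  have hparG : ∀ (x : MemberY θ.d₆ θ.ℓ₆ θ.hd' θ.hL' θ.b₀ θ.b₁ Mstar) (U : CfgY (Matrix (Fin N) (Fin N) ℂ) x.toKIdx), (∀ μ y, U μ y ∈ specialUnitaryUnits (Fin N)) →
      ∀ s s', ‖(parBY x.toKIdx U s s' : Matrix (Fin N) (Fin N) ℂ)‖ ≤ 1 ∧ ‖(((parBY x.toKIdx U s s')⁻¹ : (Matrix (Fin N) (Fin N) ℂ)ˣ) : Matrix (Fin N) (Fin N) ℂ)‖ ≤ 1 :=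
    fun x U hUG s s' => contractive_of_mem specialUnitaryUnits_le_unitaryUnits (parBY_mem x.toKIdx hUG s s')
  exact ⟨decayUnder_QGQOfY_of_majorants_R R₁ R₂ hG bK b T (fun x => parBY x.toKIdx) hparG hlev hβ1 hnbr
      ⟨M₂, a₂, C, δ, hM₂, ha₂, hC, hδ, fun x hM α₀ hα₀ hMa U hU hU' => (hmaj x hM α₀ hα₀ hMa U hU hU').1⟩,
    decayUnder_QGQOfY_of_majorants_R R₁ R₂ hG bK b T₁ (fun x => parBY x.toKIdx) hparG hlev hβ1 hnbr
      ⟨M₂, a₂, C, δ, hM₂, ha₂, hC, hδ, fun x hM α₀ hα₀ hMa U hU hU' => (hmaj x hM α₀ hα₀ hMa U hU hU').2⟩⟩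

include hG hblk hGco hG1co hlev hβ1 hnbr hθ₁ hB₀ hσ hρ hρS hρδ ha₁ hM₁ hmodel in
/-- ★ **ROW 26's TWO DECAY BINDERS AT THE CARRIER FROM ROW 20's DISPLAYED INPUTS** (Theorem 3.3 for `G₀`, the (3.131)∕(3.137) steps, `FormSmall`, the identities at
the carrier-typed pins naming `T ∕ T₁`, the static geometry, the faithful block map, the radius-`(ℓ+4)` count) — the R-twin of `B9Eq3132FacesAtLetters.hdec26_of_step12_of`.
[cite: Balaban1985BackgroundPropagators, (3.132) p.422, Thm 3.12 pp.421–423, (3.130)–(3.131), (3.137)–(3.138), (3.35)–(3.36) p.396; Balaban1984PropagatorsII, (2.142) p.248, (2.51) p.232, Lemma 2.1 (2.60)–(2.61) p.234] -/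
theorem hdec26_of_step12_of_R :
    DecayUnder c35 (fun x : MemberY θ.d₆ θ.ℓ₆ θ.hd' θ.hL' θ.b₀ θ.b₁ Mstar => geoComap (geo9Y x) (Prod.fst : (geo9Y x).Site × Ff → (geo9Y x).Site))
        (bg9YR (Matrix (Fin N) (Fin N) ℂ) (specialUnitaryUnits (Fin N)) R₁ R₂) (fun x U => normMatY b (lamInvY x.toKIdx) (QGQOfY x.toKIdx (parBY x.toKIdx) (T x) U)) ∧
      DecayUnder c35 (fun x : MemberY θ.d₆ θ.ℓ₆ θ.hd' θ.hL' θ.b₀ θ.b₁ Mstar => geoComap (geo9Y x) (Prod.fst : (geo9Y x).Site × Ff → (geo9Y x).Site))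
        (bg9YR (Matrix (Fin N) (Fin N) ℂ) (specialUnitaryUnits (Fin N)) R₁ R₂) (fun x U => normMatY b (lamInvY x.toKIdx) (QGQOfY x.toKIdx (parBY x.toKIdx) (T₁ x) U)) :=
  hdec26_of_majorants_of_R θ Mstar R₁ R₂ hG bK b T T₁ hlev hβ1 hnbr (R := fun _ => 1)
    (majorants_of_step12_R R₁ R₂ (G := specialUnitaryUnits (Fin N)) bK 𝔬 H₀ T T₁ hblk hGco hG1co θ₁ r₁ B₀ δ₀ δK σ ρ a₁ M₁ hθ₁ hB₀ hσ hρ hρS hρδ ha₁ hM₁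
      hgeo hmodel)

/-! ## §4 ★★ ROW 26's TWO COERCIVITY BINDERS AT THE CARRIER, FROM ONE FOR `T₀` — AND THAT ONE FROM ROW 17 + THE TENT ENERGY -/

include hG hblk hGco hG1co hG0co hlev hβ1 hnbr hθ₁ hB₀ hσ hρ hρS hρδ ha₁ hM₁ hmodel in
/-- ★ **THE COERCIVITY BINDERS FOR `(Q T(U) Q*)` AND `(Q T₁(U) Q*)` AT THE CARRIER FROM ONE FOR `(Q T₀(U) Q*)` AND ROW 20's DISPLAYED INPUTS** — the R-twin of
`B9Eq3132FacesAtLetters.hco26_of_hcoA_step12_of` (`hG` for the contractivity of `parBY`).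
[cite: Balaban1985BackgroundPropagators, (3.132) p.422, Thm 3.12 pp.421–423, (3.130)–(3.131), (3.137)–(3.138), (3.35) p.396; Balaban1984PropagatorsII, (2.147) p.249, (2.142) p.248, (2.51) p.232, Lemma 2.1 (2.60)–(2.61) p.234] -/
theorem hco26_of_hcoA_step12_of_R
    (hcoA : CoerciveUnder c35 (fun x : MemberY θ.d₆ θ.ℓ₆ θ.hd' θ.hL' θ.b₀ θ.b₁ Mstar => geoComap (geo9Y x) (Prod.fst : (geo9Y x).Site × Ff → (geo9Y x).Site))
      (bg9YR (Matrix (Fin N) (Fin N) ℂ) (specialUnitaryUnits (Fin N)) R₁ R₂) (fun x U => normMatY b (lamInvY x.toKIdx) (QGQOfY x.toKIdx (parBY x.toKIdx) (T₀ x) U))) :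
    CoerciveUnder c35 (fun x : MemberY θ.d₆ θ.ℓ₆ θ.hd' θ.hL' θ.b₀ θ.b₁ Mstar => geoComap (geo9Y x) (Prod.fst : (geo9Y x).Site × Ff → (geo9Y x).Site))
        (bg9YR (Matrix (Fin N) (Fin N) ℂ) (specialUnitaryUnits (Fin N)) R₁ R₂) (fun x U => normMatY b (lamInvY x.toKIdx) (QGQOfY x.toKIdx (parBY x.toKIdx) (T x) U)) ∧
      CoerciveUnder c35 (fun x : MemberY θ.d₆ θ.ℓ₆ θ.hd' θ.hL' θ.b₀ θ.b₁ Mstar => geoComap (geo9Y x) (Prod.fst : (geo9Y x).Site × Ff → (geo9Y x).Site))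
        (bg9YR (Matrix (Fin N) (Fin N) ℂ) (specialUnitaryUnits (Fin N)) R₁ R₂) (fun x U => normMatY b (lamInvY x.toKIdx) (QGQOfY x.toKIdx (parBY x.toKIdx) (T₁ x) U)) := by
  have hparG : ∀ (x : MemberY θ.d₆ θ.ℓ₆ θ.hd' θ.hL' θ.b₀ θ.b₁ Mstar) (U : CfgY (Matrix (Fin N) (Fin N) ℂ) x.toKIdx), (∀ μ y, U μ y ∈ specialUnitaryUnits (Fin N)) →
      ∀ s s', ‖(parBY x.toKIdx U s s' : Matrix (Fin N) (Fin N) ℂ)‖ ≤ 1 ∧ ‖(((parBY x.toKIdx U s s')⁻¹ : (Matrix (Fin N) (Fin N) ℂ)ˣ) : Matrix (Fin N) (Fin N) ℂ)‖ ≤ 1 :=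
    fun x U hUG s s' => contractive_of_mem specialUnitaryUnits_le_unitaryUnits (parBY_mem x.toKIdx hUG s s')
  obtain ⟨M₂, a₂, C, δ, hM₂, ha₂, hC, hδ, hmaj⟩ := subMajorants_of_step12_R R₁ R₂ (G := specialUnitaryUnits (Fin N)) bK 𝔬 H₀ T T₁ T₀
    hblk hGco hG1co hG0co θ₁ r₁ B₀ δ₀ δK σ ρ a₁ M₁ hθ₁ hB₀ hσ hρ hρS hρδ ha₁ hM₁ hgeo hmodel
  exact ⟨coerciveUnder_of_subMajorants_R R₁ R₂ hG bK b T T₀ (fun x => parBY x.toKIdx) hparG hlev hβ1 hnbr (R := fun _ => 1) hcoA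
      ⟨M₂, a₂, C, δ, hM₂, ha₂, hC, hδ, fun x hM α₀ hα₀ hMa U hU hU' => (hmaj x hM α₀ hα₀ hMa U hU hU').1⟩,
    coerciveUnder_of_subMajorants_R R₁ R₂ hG bK b T₁ T₀ (fun x => parBY x.toKIdx) hparG hlev hβ1 hnbr (R := fun _ => 1) hcoA
      ⟨M₂, a₂, C, δ, hM₂, ha₂, hC, hδ, fun x hM α₀ hα₀ hMa U hU hU' => (hmaj x hM α₀ hα₀ hMa U hU hU').2⟩⟩

include hG hT₀ hblk hGco hG1co hG0co hlev hβ1 hnbr hθ₁ hB₀ hσ hρ hρS hρδ ha₁ hM₁ hmodel ha311 hM311 hΔA hP1 in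
/-- ★★ **ROW 26's TWO COERCIVITY BINDERS AT THE CARRIER FROM ROW 17, THE DISPLAYED TENT ENERGY AND ROW 20's INPUTS** (basis `trBasis N`, family index `TrIdx N`;
`T₀ = Δ_a⁻¹` by `hT₀`) — the R-twin of `B9Eq3132FacesAtLetters.hco26_of_energy_step12_of` (`hcoA := B9Eq3132CoerciveFromEnergyR.hcoA_of_energy_R`).
[cite: Balaban1985BackgroundPropagators, (3.132) p.422, Thm 3.12 pp.421–423, Thm 3.11 p.416, (3.35) p.396; Balaban1984PropagatorsII, (2.147) p.248] -/
theorem hco26_of_energy_step12_of_R :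
    CoerciveUnder c35 (fun x : MemberY θ.d₆ θ.ℓ₆ θ.hd' θ.hL' θ.b₀ θ.b₁ Mstar => geoComap (geo9Y x) (Prod.fst : (geo9Y x).Site × TrIdx N → (geo9Y x).Site))
        (bg9YR (Matrix (Fin N) (Fin N) ℂ) (specialUnitaryUnits (Fin N)) R₁ R₂) (fun x U => normMatY (trBasis N) (lamInvY x.toKIdx) (QGQOfY x.toKIdx (parBY x.toKIdx) (T x) U)) ∧
      CoerciveUnder c35 (fun x : MemberY θ.d₆ θ.ℓ₆ θ.hd' θ.hL' θ.b₀ θ.b₁ Mstar => geoComap (geo9Y x) (Prod.fst : (geo9Y x).Site × TrIdx N → (geo9Y x).Site))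
        (bg9YR (Matrix (Fin N) (Fin N) ℂ) (specialUnitaryUnits (Fin N)) R₁ R₂) (fun x U => normMatY (trBasis N) (lamInvY x.toKIdx) (QGQOfY x.toKIdx (parBY x.toKIdx) (T₁ x) U)) :=
  hco26_of_hcoA_step12_of_R θ Mstar R₁ R₂ hG bK (trBasis N) 𝔬 H₀ T T₁ T₀ hblk hGco hG1co hG0co hlev hβ1 hnbr θ₁ r₁ B₀ δ₀ δK σ ρ a₁ M₁ hθ₁ hB₀ hσ hρ hρS hρδ
    ha₁ hM₁ hgeo hmodel (hcoA_of_energy_R θ Mstar R₁ R₂ hG T₀ hT₀ a311 M311 ha311 hM311 hΔA hP1)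

include hG hY hT₀ hblk hGco hG1co hG0co hlev hβ1 hnbr hθ₁ hB₀ hσ hρ hρS hρδ ha₁ hM₁ hmodel ha311 hM311 hΔA in
/-- ★★ **ROW 26's TWO COERCIVITY BINDERS AT THE CARRIER FROM ROW 17 AND ROW 20's INPUTS, THE TENT ENERGY DISCHARGED BY A REFINEMENT OF MODULE 3's CLASS** (`hY`;
`hcoA := B9Eq3132CoerciveFromEnergyR.hcoA_of_refinesY_R`, i.e. my g14 `hP1_of_reg335 θ M⋆ c′` read at the carrier) — the R-twin of `B9Eq3132FacesAtLetters.hco26_of_reg335_step12_of`.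
[cite: Balaban1985BackgroundPropagators, (3.132) p.422, Thm 3.12 pp.421–423, Thm 3.11 p.416, (3.35)–(3.36) p.396, (3.69) p.404; Balaban1984PropagatorsII, (2.147) p.248] -/
theorem hco26_of_refinesY_step12_of_R :
    CoerciveUnder c35 (fun x : MemberY θ.d₆ θ.ℓ₆ θ.hd' θ.hL' θ.b₀ θ.b₁ Mstar => geoComap (geo9Y x) (Prod.fst : (geo9Y x).Site × TrIdx N → (geo9Y x).Site))
        (bg9YR (Matrix (Fin N) (Fin N) ℂ) (specialUnitaryUnits (Fin N)) R₁ R₂) (fun x U => normMatY (trBasis N) (lamInvY x.toKIdx) (QGQOfY x.toKIdx (parBY x.toKIdx) (T x) U)) ∧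
      CoerciveUnder c35 (fun x : MemberY θ.d₆ θ.ℓ₆ θ.hd' θ.hL' θ.b₀ θ.b₁ Mstar => geoComap (geo9Y x) (Prod.fst : (geo9Y x).Site × TrIdx N → (geo9Y x).Site))
        (bg9YR (Matrix (Fin N) (Fin N) ℂ) (specialUnitaryUnits (Fin N)) R₁ R₂) (fun x U => normMatY (trBasis N) (lamInvY x.toKIdx) (QGQOfY x.toKIdx (parBY x.toKIdx) (T₁ x) U)) :=
  hco26_of_hcoA_step12_of_R θ Mstar R₁ R₂ hG bK (trBasis N) 𝔬 H₀ T T₁ T₀ hblk hGco hG1co hG0co hlev hβ1 hnbr θ₁ r₁ B₀ δ₀ δK σ ρ a₁ M₁ hθ₁ hB₀ hσ hρ hρS hρδ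
    ha₁ hM₁ hgeo hmodel (hcoA_of_refinesY_R θ Mstar R₁ R₂ hG hY T₀ hT₀ a311 M311 ha311 hM311 hΔA)

/-! ## §5 ★★★ ROW 26 OF THE R-GENERIC CERTIFICATE IN ONE CALL -/

include hG hT₀ hblk hGco hG1co hG0co hlev hβ1 hnbr hθ₁ hB₀ hσ hρ hρS hρδ ha₁ hM₁ hmodel ha311 hM311 hΔA hP1 in
/-- ★★★ **ROW 26 OF THE R-GENERIC CERTIFICATE AT THE `ν`-INSTANCE OVER A LETTERS FAMILY `𝔏`, FROM ROW 20's DISPLAYED INPUTS, ROW 17's `hΔA`, THE DISPLAYED TENT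
ENERGY `hP1` AND `hG : MemOfFam SU(N) R₁`** (§3 + §4 + §1): for ANY `𝔏` whose `(QGQ*)⁻¹ ∕ (QG₁Q*)⁻¹` fields are `U ↦ Ring.inverse (Q_U T(U) Q*_U)`,
`U ↦ Ring.inverse (Q_U T₁(U) Q*_U)` (`hQ ∕ hQ₁`, `rfl` at every `withSectD ∕ withDE`-built record with `T := (𝔏 x).GD`, `T₁ := (𝔏 x).G₁`) and whose carrier-typed walk
model is pinned at `T ∕ T₁ ∕ T₀ = Δ_a⁻¹`: `B9.Stmt3132Printed (d+1) c35 geo9Y (bg9YR … R₁ R₂)` for the two kernels READ THROUGH `siteKernelR R₁ R₂` — the `s3132` binder of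
`b9LeafX_carriersYR` at the certificate's instance shape.  The R-twin of `B9Eq3132FacesAtLetters.s3132Nu_opsYSectE_of_step12`.
[cite: Balaban1985BackgroundPropagators, (3.132) p.422, Thm 3.12 pp.421–423, Thm 3.11 p.416, (3.35)–(3.36) p.396; Balaban1984PropagatorsII, (2.142) (2.147) p.248, Prop. 2.7 (2.149) p.249] -/
theorem s3132Nu_opsYSectE_of_step12_R (𝔏 : LettersY N θ Mstar) (𝔈 : ExpsY N θ Mstar) (𝔢 : SectEY N θ Mstar) (𝔴 : RWEY N θ Mstar)
    (hQ : ∀ x : MemberY θ.d₆ θ.ℓ₆ θ.hd' θ.hL' θ.b₀ θ.b₁ Mstar, (𝔏 x).QGQinv = fun U => Ring.inverse (QGQOfY x.toKIdx (parBY x.toKIdx) (T x) U))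
    (hQ₁ : ∀ x : MemberY θ.d₆ θ.ℓ₆ θ.hd' θ.hL' θ.b₀ θ.b₁ Mstar, (𝔏 x).QG1Qinv = fun U => Ring.inverse (QGQOfY x.toKIdx (parBY x.toKIdx) (T₁ x) U)) :
    B9.Stmt3132Printed (θ.d₆ + 1) c35 (geo9Y (d := θ.d₆) (ℓ := θ.ℓ₆) (hd := θ.hd') (hL := θ.hL') (b₀ := θ.b₀) (b₁ := θ.b₁) (Mstar := Mstar))
      (bg9YR (Matrix (Fin N) (Fin N) ℂ) (specialUnitaryUnits (Fin N)) R₁ R₂)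
      (fun x => siteKernelR R₁ R₂ (opsYSectE N θ Mstar (opsYS349NuOfLetters N θ Mstar 𝔏 𝔈) 𝔏 𝔢 𝔴 x).QGQinv)
      (fun x => siteKernelR R₁ R₂ (opsYSectE N θ Mstar (opsYS349NuOfLetters N θ Mstar 𝔏 𝔈) 𝔏 𝔢 𝔴 x).QG1Qinv) := by
  obtain ⟨hdec, hdec₁⟩ := hdec26_of_step12_of_R θ Mstar R₁ R₂ hG bK (trBasis N) 𝔬 H₀ T T₁ hblk hGco hG1co hlev hβ1 hnbr θ₁ r₁ B₀ δ₀ δK σ ρ a₁ M₁ hθ₁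
    hB₀ hσ hρ hρS hρδ ha₁ hM₁ hgeo hmodel
  obtain ⟨hco, hco₁⟩ := hco26_of_energy_step12_of_R θ Mstar R₁ R₂ hG bK 𝔬 H₀ T T₁ T₀ hT₀ hblk hGco hG1co hG0co hlev hβ1 hnbr θ₁ r₁ B₀ δ₀ δK σ ρ a₁ M₁
    hθ₁ hB₀ hσ hρ hρS hρδ ha₁ hM₁ hgeo hmodel a311 M311 ha311 hM311 hΔA hP1
  exact s3132Nu_opsYSectE_of_ringInverse_R θ Mstar R₁ R₂ 𝔏 𝔈 𝔢 𝔴 (trBasis N) (fun x U => QGQOfY x.toKIdx (parBY x.toKIdx) (T x) U)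
    (fun x U => QGQOfY x.toKIdx (parBY x.toKIdx) (T₁ x) U) hQ hQ₁ hco hdec hco₁ hdec₁

include hG hY hT₀ hblk hGco hG1co hG0co hlev hβ1 hnbr hθ₁ hB₀ hσ hρ hρS hρδ ha₁ hM₁ hmodel ha311 hM311 hΔA in
/-- ★★★ **ROW 26 OF THE R-GENERIC CERTIFICATE, THE TENT ENERGY DISCHARGED BY A REFINEMENT OF MODULE 3's CLASS** — `s3132Nu_opsYSectE_of_step12_R` with
`hP1 := B9Eq3132CoerciveFromEnergyR.hP1_R_of_refinesY hY`: displays for row 26, besides ROW 20's inputs and ROW 17's `hΔA`, only the two class binders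
`hG : MemOfFam SU(N) R₁` and `hY` (refinement of `(regY335, regY336)` at some `c′`).  At MODULE 3's families (`hG := memOfFam_regY335`, `hY := fun _ _ _ h h' => ⟨h, h'⟩`,
`c′ = c35`) this is `B9Eq3132FacesAtLetters.s3132Nu_opsYSectE_of_step12` read at the carrier; at print's class `hY` is dag-n06-j's bridge (`c′ = 10·L³ ∕ 10·L⁴`).
[cite: Balaban1985BackgroundPropagators, (3.132) p.422, Thm 3.12 pp.421–423, Thm 3.11 p.416, (3.35)–(3.36) p.396, (3.69) p.404; Balaban1984PropagatorsII, (2.142) (2.147) p.248, Prop. 2.7 (2.149) p.249] -/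
theorem s3132Nu_opsYSectE_of_step12_R_of_refinesY (𝔏 : LettersY N θ Mstar) (𝔈 : ExpsY N θ Mstar) (𝔢 : SectEY N θ Mstar) (𝔴 : RWEY N θ Mstar)
    (hQ : ∀ x : MemberY θ.d₆ θ.ℓ₆ θ.hd' θ.hL' θ.b₀ θ.b₁ Mstar, (𝔏 x).QGQinv = fun U => Ring.inverse (QGQOfY x.toKIdx (parBY x.toKIdx) (T x) U))
    (hQ₁ : ∀ x : MemberY θ.d₆ θ.ℓ₆ θ.hd' θ.hL' θ.b₀ θ.b₁ Mstar, (𝔏 x).QG1Qinv = fun U => Ring.inverse (QGQOfY x.toKIdx (parBY x.toKIdx) (T₁ x) U)) :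
    B9.Stmt3132Printed (θ.d₆ + 1) c35 (geo9Y (d := θ.d₆) (ℓ := θ.ℓ₆) (hd := θ.hd') (hL := θ.hL') (b₀ := θ.b₀) (b₁ := θ.b₁) (Mstar := Mstar))
      (bg9YR (Matrix (Fin N) (Fin N) ℂ) (specialUnitaryUnits (Fin N)) R₁ R₂)
      (fun x => siteKernelR R₁ R₂ (opsYSectE N θ Mstar (opsYS349NuOfLetters N θ Mstar 𝔏 𝔈) 𝔏 𝔢 𝔴 x).QGQinv)
      (fun x => siteKernelR R₁ R₂ (opsYSectE N θ Mstar (opsYS349NuOfLetters N θ Mstar 𝔏 𝔈) 𝔏 𝔢 𝔴 x).QG1Qinv) := by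
  obtain ⟨hdec, hdec₁⟩ := hdec26_of_step12_of_R θ Mstar R₁ R₂ hG bK (trBasis N) 𝔬 H₀ T T₁ hblk hGco hG1co hlev hβ1 hnbr θ₁ r₁ B₀ δ₀ δK σ ρ a₁ M₁ hθ₁
    hB₀ hσ hρ hρS hρδ ha₁ hM₁ hgeo hmodel
  obtain ⟨hco, hco₁⟩ := hco26_of_refinesY_step12_of_R θ Mstar R₁ R₂ hG bK 𝔬 H₀ T T₁ T₀ hT₀ hblk hGco hG1co hG0co hlev hβ1 hnbr θ₁ r₁ B₀ δ₀ δK σ ρ a₁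
    M₁ hθ₁ hB₀ hσ hρ hρS hρδ ha₁ hM₁ hgeo hmodel a311 M311 ha311 hM311 hΔA hY
  exact s3132Nu_opsYSectE_of_ringInverse_R θ Mstar R₁ R₂ 𝔏 𝔈 𝔢 𝔴 (trBasis N) (fun x U => QGQOfY x.toKIdx (parBY x.toKIdx) (T x) U)
    (fun x U => QGQOfY x.toKIdx (parBY x.toKIdx) (T₁ x) U) hQ hQ₁ hco hdec hco₁ hdec₁

end Faces

/-! ## §6 (v1.1, appended) Row 26 with the refinement GUARDED by `0 < α₀` — the shape dag-n06-j's P-bridge inhabits -/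

section FacesPos

variable (θ : Stage3Params) (Mstar : ℕ) (R₁ R₂ : RegFamY θ.d₆ θ.ℓ₆ θ.hd' θ.hL' θ.b₀ θ.b₁ Mstar (Matrix (Fin N) (Fin N) ℂ))
  (hG : MemOfFam (specialUnitaryUnits (Fin N)) R₁)
  [∀ x : MemberY θ.d₆ θ.ℓ₆ θ.hd' θ.hL' θ.b₀ θ.b₁ Mstar, Fintype (geo9Y x).Site] [∀ x : MemberY θ.d₆ θ.ℓ₆ θ.hd' θ.hL' θ.b₀ θ.b₁ Mstar, DecidableEq (geo9Y x).Site]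
  {Y Z W : MemberY θ.d₆ θ.ℓ₆ θ.hd' θ.hL' θ.b₀ θ.b₁ Mstar → Type} [∀ x, Fintype (Z x)] [∀ x, Fintype (W x)]
  (bK : Module.Basis κ ℝ (Matrix (Fin N) (Fin N) ℂ)) {c35 : ℝ}
  (𝔬 : ∀ x : MemberY θ.d₆ θ.ℓ₆ θ.hd' θ.hL' θ.b₀ θ.b₁ Mstar, Ops (geo9Y x) (bg9YR (Matrix (Fin N) (Fin N) ℂ) (specialUnitaryUnits (Fin N)) R₁ R₂ x) (XBK κ x.toKIdx) (Y x) (Z x) (W x))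
  (H₀ : MemberY θ.d₆ θ.ℓ₆ θ.hd' θ.hL' θ.b₀ θ.b₁ Mstar → Prop)
  (T T₁ T₀ : ∀ x : MemberY θ.d₆ θ.ℓ₆ θ.hd' θ.hL' θ.b₀ θ.b₁ Mstar, BondOpY (Matrix (Fin N) (Fin N) ℂ) x.toKIdx)
  (hT₀ : ∀ (x : MemberY θ.d₆ θ.ℓ₆ θ.hd' θ.hL' θ.b₀ θ.b₁ Mstar) (U : CfgY (Matrix (Fin N) (Fin N) ℂ) x.toKIdx), T₀ x U = Ring.inverse (deltaAY x.toKIdx (parSymY x.toKIdx) (parBY x.toKIdx) (GpY x.toKIdx (parSymY x.toKIdx)) U))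
  {bI : ∀ x : MemberY θ.d₆ θ.ℓ₆ θ.hd' θ.hL' θ.b₀ θ.b₁ Mstar, FBondY x.toKIdx → IBondY x.toKIdx} (hblk : ∀ x, (𝔬 x).blk = blkBK x.toKIdx (bI x))
  (hGco : ∀ (x : MemberY θ.d₆ θ.ℓ₆ θ.hd' θ.hL' θ.b₀ θ.b₁ Mstar) (U : (bg9YR (Matrix (Fin N) (Fin N) ℂ) (specialUnitaryUnits (Fin N)) R₁ R₂ x).Cfg), (𝔬 x).G U = GcoK x.toKIdx bK (bg9YR (Matrix (Fin N) (Fin N) ℂ) (specialUnitaryUnits (Fin N)) R₁ R₂ x) (fun U => U) (T x) U)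
  (hG1co : ∀ (x : MemberY θ.d₆ θ.ℓ₆ θ.hd' θ.hL' θ.b₀ θ.b₁ Mstar) (U : (bg9YR (Matrix (Fin N) (Fin N) ℂ) (specialUnitaryUnits (Fin N)) R₁ R₂ x).Cfg), (𝔬 x).G1 U = GcoK x.toKIdx bK (bg9YR (Matrix (Fin N) (Fin N) ℂ) (specialUnitaryUnits (Fin N)) R₁ R₂ x) (fun U => U) (T₁ x) U)
  (hG0co : ∀ (x : MemberY θ.d₆ θ.ℓ₆ θ.hd' θ.hL' θ.b₀ θ.b₁ Mstar) (U : (bg9YR (Matrix (Fin N) (Fin N) ℂ) (specialUnitaryUnits (Fin N)) R₁ R₂ x).Cfg), (𝔬 x).G0 U = GcoK x.toKIdx bK (bg9YR (Matrix (Fin N) (Fin N) ℂ) (specialUnitaryUnits (Fin N)) R₁ R₂ x) (fun U => U) (T₀ x) U)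
  (hlev : ∀ (x : MemberY θ.d₆ θ.ℓ₆ θ.hd' θ.hL' θ.b₀ θ.b₁ Mstar) (f : FBondY x.toKIdx), lvl x.hN x.D x.hk (bI x f) = (blkV1 x.hN x.D f).1.1)
  (hβ1 : ∀ (x : MemberY θ.d₆ θ.ℓ₆ θ.hd' θ.hL' θ.b₀ θ.b₁ Mstar) (f : FBondY x.toKIdx), (B6Geom246MultiLevelTorus.geomT x.D).dist (β x.hN x.D x.hk (bI x f)) (blkV1 x.hN x.D f) ≤ 1)
  {mN : ℕ} (hnbr : ∀ (x : MemberY θ.d₆ θ.ℓ₆ θ.hd' θ.hL' θ.b₀ θ.b₁ Mstar) (y : (geo9Y x).Site), (nbr (geo9Y x) ((θ.ℓ₆ : ℝ) + 4) y).card ≤ mN)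
  (θ₁ r₁ B₀ δ₀ δK σ ρ a₁ M₁ : ℝ) (hθ₁ : 0 ≤ θ₁) (hB₀ : 0 ≤ B₀) (hσ : 0 < σ) (hρ : 0 < ρ) (hρS : ρ ≤ δ₀) (hρδ : ρ + σ ≤ δK)
  (ha₁ : 0 < a₁) (hM₁ : 0 < M₁) (hgeo : ∀ x : MemberY θ.d₆ θ.ℓ₆ θ.hd' θ.hL' θ.b₀ θ.b₁ Mstar, GeoOK (geo9Y x))
  (hmodel : ∀ x : MemberY θ.d₆ θ.ℓ₆ θ.hd' θ.hL' θ.b₀ θ.b₁ Mstar, M₁ ≤ (geo9Y x).M → ∀ α₀ : ℝ, 0 < α₀ → (geo9Y x).M * α₀ ≤ a₁ → ∀ U : (bg9YR (Matrix (Fin N) (Fin N) ℂ) (specialUnitaryUnits (Fin N)) R₁ R₂ x).Cfg,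
    (bg9YR (Matrix (Fin N) (Fin N) ℂ) (specialUnitaryUnits (Fin N)) R₁ R₂ x).Reg335 c35 α₀ U → (bg9YR (Matrix (Fin N) (Fin N) ℂ) (specialUnitaryUnits (Fin N)) R₁ R₂ x).Reg336 c35 α₀ U →
      Thm33G0 (𝔬 x) 1 (H₀ x) B₀ δ₀ U ∧ Step (𝔬 x) 1 (H₀ x) (hgeo x).lenle 1 (θ₁ * ((geo9Y x).M * α₀)) δK U ∧
        Step (𝔬 x) 1 (H₀ x) (hgeo x).lenle 2 (θ₁ * ((geo9Y x).M * α₀)) δK U ∧ FormSmall (𝔬 x) (r₁ * ((geo9Y x).M * α₀)) U ∧ Identities (𝔬 x) U)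
  (a311 M311 : ℝ) (ha311 : 0 < a311) (hM311 : 0 < M311)
  (hΔA : ∀ x : MemberY θ.d₆ θ.ℓ₆ θ.hd' θ.hL' θ.b₀ θ.b₁ Mstar, M311 ≤ (geo9Y x).M → ∀ α₀ : ℝ, 0 < α₀ → (geo9Y x).M * α₀ ≤ a311 → ∀ U : (bg9YR (Matrix (Fin N) (Fin N) ℂ) (specialUnitaryUnits (Fin N)) R₁ R₂ x).Cfg, (bg9YR (Matrix (Fin N) (Fin N) ℂ) (specialUnitaryUnits (Fin N)) R₁ R₂ x).Reg335 c35 α₀ U →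
    PosDefTr (fun _ => (1 : ℝ)) (deltaAY x.toKIdx (parSymY x.toKIdx) (parBY x.toKIdx) (GpY x.toKIdx (parSymY x.toKIdx)) U))
  -- the refinement of MODULE 3's class at some constant `c′`, asked only for `0 < α₀`
  {c' : ℝ}
  (hY : ∀ (x : MemberY θ.d₆ θ.ℓ₆ θ.hd' θ.hL' θ.b₀ θ.b₁ Mstar) (α₀ : ℝ) (U : CfgY (Matrix (Fin N) (Fin N) ℂ) x.toKIdx), 0 < α₀ → R₁ x c35 α₀ U → R₂ x c35 α₀ U →
    regY335 (Matrix (Fin N) (Fin N) ℂ) (specialUnitaryUnits (Fin N)) x c' α₀ U ∧ regY336 (Matrix (Fin N) (Fin N) ℂ) (specialUnitaryUnits (Fin N)) x c' α₀ U)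

include hG hY hT₀ hblk hGco hG1co hG0co hlev hβ1 hnbr hθ₁ hB₀ hσ hρ hρS hρδ ha₁ hM₁ hmodel ha311 hM311 hΔA in
/-- ★★ **ROW 26's TWO COERCIVITY BINDERS AT THE CARRIER, THE TENT ENERGY DISCHARGED BY THE `α₀`-GUARDED REFINEMENT** (v1.1; `hcoA :=
B9Eq3132CoerciveFromEnergyR.hcoA_of_refinesYPos_R`). [cite: Balaban1985BackgroundPropagators, (3.132) p.422, Thm 3.12 pp.421–423, Thm 3.11 p.416, (3.35)–(3.36) p.396, (3.69) p.404; Balaban1984PropagatorsII, (2.147) p.248] -/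
theorem hco26_of_refinesYPos_step12_of_R :
    CoerciveUnder c35 (fun x : MemberY θ.d₆ θ.ℓ₆ θ.hd' θ.hL' θ.b₀ θ.b₁ Mstar => geoComap (geo9Y x) (Prod.fst : (geo9Y x).Site × TrIdx N → (geo9Y x).Site))
        (bg9YR (Matrix (Fin N) (Fin N) ℂ) (specialUnitaryUnits (Fin N)) R₁ R₂) (fun x U => normMatY (trBasis N) (lamInvY x.toKIdx) (QGQOfY x.toKIdx (parBY x.toKIdx) (T x) U)) ∧
      CoerciveUnder c35 (fun x : MemberY θ.d₆ θ.ℓ₆ θ.hd' θ.hL' θ.b₀ θ.b₁ Mstar => geoComap (geo9Y x) (Prod.fst : (geo9Y x).Site × TrIdx N → (geo9Y x).Site))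
        (bg9YR (Matrix (Fin N) (Fin N) ℂ) (specialUnitaryUnits (Fin N)) R₁ R₂) (fun x U => normMatY (trBasis N) (lamInvY x.toKIdx) (QGQOfY x.toKIdx (parBY x.toKIdx) (T₁ x) U)) :=
  hco26_of_hcoA_step12_of_R θ Mstar R₁ R₂ hG bK (trBasis N) 𝔬 H₀ T T₁ T₀ hblk hGco hG1co hG0co hlev hβ1 hnbr θ₁ r₁ B₀ δ₀ δK σ ρ a₁ M₁ hθ₁ hB₀ hσ hρ hρS hρδ
    ha₁ hM₁ hgeo hmodel (hcoA_of_refinesYPos_R θ Mstar R₁ R₂ hG hY T₀ hT₀ a311 M311 ha311 hM311 hΔA)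

include hG hY hT₀ hblk hGco hG1co hG0co hlev hβ1 hnbr hθ₁ hB₀ hσ hρ hρS hρδ ha₁ hM₁ hmodel ha311 hM311 hΔA in
/-- ★★★ **ROW 26 OF THE R-GENERIC CERTIFICATE, THE TENT ENERGY DISCHARGED BY THE `α₀`-GUARDED REFINEMENT** (v1.1) — `s3132Nu_opsYSectE_of_step12_R` with
`hP1 := hP1_R_of_refinesYPos hY`; the RECOMMENDED knit form: at MODULE 3's families `hY := fun _ _ _ _ h h' => ⟨h, h'⟩` (`c′ = c35`), at print's class
`hY := fun x α₀ U hα h h' => ⟨regY335_of_regYP335 x hc hα.le h (…), regY336_of_regYP336 x hc hα.le h' le_rfl⟩` (`c′ = 10·L⁴`, dag-n06-j).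
[cite: Balaban1985BackgroundPropagators, (3.132) p.422, Thm 3.12 pp.421–423, Thm 3.11 p.416, (3.35)–(3.36) p.396, (3.69) p.404; Balaban1984PropagatorsII, (2.142) (2.147) p.248, Prop. 2.7 (2.149) p.249] -/
theorem s3132Nu_opsYSectE_of_step12_R_of_refinesYPos (𝔏 : LettersY N θ Mstar) (𝔈 : ExpsY N θ Mstar) (𝔢 : SectEY N θ Mstar) (𝔴 : RWEY N θ Mstar)
    (hQ : ∀ x : MemberY θ.d₆ θ.ℓ₆ θ.hd' θ.hL' θ.b₀ θ.b₁ Mstar, (𝔏 x).QGQinv = fun U => Ring.inverse (QGQOfY x.toKIdx (parBY x.toKIdx) (T x) U))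
    (hQ₁ : ∀ x : MemberY θ.d₆ θ.ℓ₆ θ.hd' θ.hL' θ.b₀ θ.b₁ Mstar, (𝔏 x).QG1Qinv = fun U => Ring.inverse (QGQOfY x.toKIdx (parBY x.toKIdx) (T₁ x) U)) :
    B9.Stmt3132Printed (θ.d₆ + 1) c35 (geo9Y (d := θ.d₆) (ℓ := θ.ℓ₆) (hd := θ.hd') (hL := θ.hL') (b₀ := θ.b₀) (b₁ := θ.b₁) (Mstar := Mstar))
      (bg9YR (Matrix (Fin N) (Fin N) ℂ) (specialUnitaryUnits (Fin N)) R₁ R₂)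
      (fun x => siteKernelR R₁ R₂ (opsYSectE N θ Mstar (opsYS349NuOfLetters N θ Mstar 𝔏 𝔈) 𝔏 𝔢 𝔴 x).QGQinv)
      (fun x => siteKernelR R₁ R₂ (opsYSectE N θ Mstar (opsYS349NuOfLetters N θ Mstar 𝔏 𝔈) 𝔏 𝔢 𝔴 x).QG1Qinv) := by
  obtain ⟨hdec, hdec₁⟩ := hdec26_of_step12_of_R θ Mstar R₁ R₂ hG bK (trBasis N) 𝔬 H₀ T T₁ hblk hGco hG1co hlev hβ1 hnbr θ₁ r₁ B₀ δ₀ δK σ ρ a₁ M₁ hθ₁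
    hB₀ hσ hρ hρS hρδ ha₁ hM₁ hgeo hmodel
  obtain ⟨hco, hco₁⟩ := hco26_of_refinesYPos_step12_of_R θ Mstar R₁ R₂ hG bK 𝔬 H₀ T T₁ T₀ hT₀ hblk hGco hG1co hG0co hlev hβ1 hnbr θ₁ r₁ B₀ δ₀ δK σ ρ
    a₁ M₁ hθ₁ hB₀ hσ hρ hρS hρδ ha₁ hM₁ hgeo hmodel a311 M311 ha311 hM311 hΔA hY
  exact s3132Nu_opsYSectE_of_ringInverse_R θ Mstar R₁ R₂ 𝔏 𝔈 𝔢 𝔴 (trBasis N) (fun x U => QGQOfY x.toKIdx (parBY x.toKIdx) (T x) U)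
    (fun x U => QGQOfY x.toKIdx (parBY x.toKIdx) (T₁ x) U) hQ hQ₁ hco hdec hco₁ hdec₁

end FacesPos

end Literature.MathematicalPhysics.QuantumFieldTheory.Balaban1983to89.B9Eq3132FacesAtLettersR

end
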